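import Mathlib
import HarnessLib
import Summits.FinalStateConjecture.Statement
import Literature.Geometry.Lorentzian.CoordCurvature
import Literature.Geometry.Lorentzian.KerrSchild

/-!
# Route TemporalBandLiouville — assembly item `Assembly` (stmt-FinalStateConjecture-10176)

Pure logic. The route decl
`Summit.FinalStateConjecture.FinalStateConjecture.Theses.TemporalBandLiouville.Assembly` reads
`BandFromNonradiation → BandLimitedLiouville → StationaryLimitReduction → FinalStateConjecture`
with `StationaryLimitReduction := EternalExteriorStationary → FinalStateConjecture`.

The two cruxes
* C1 = `BandFromNonradiation` — an eternal, two-sided `C^k`-bounded, non-radiating harmonic-gauge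
  vacuum exterior `G` on the excised cylinder `Kerr.region a r₀` is band-limited in `t`, and
* C2 = `BandLimitedLiouville` — the same hypotheses plus such a temporal band force `t`-independence,

compose (their hypothesis bundles are syntactically identical and the conclusion of C1 is literally
the extra hypothesis of C2) to the route target X = `EternalExteriorStationary`; the reduction
R = `StationaryLimitReduction : X → FinalStateConjecture` then yields the Statement. So the proof is
`fun hB hL hR => hR (fun a r₀ G hG => hL a r₀ G hG (hB a r₀ G hG))`.

Design (pattern of `Theorems/TemporalBandLiouvilleTargetOfCruxes.lean`,
`Theorems/PhotonSphereChannelsAssemblyFrame.lean`): this module does NOT import the route module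
`Summits.FinalStateConjecture.FinalStateConjecture.Theses.TemporalBandLiouville`. When the item
closes, the gate re-renders the route file with `import <this module>` and
`theorem Assembly_holds : Assembly := …`; a closing module importing the route file would make that
an import cycle. Hence the theorem below states the four bodies VERBATIM (copied from the route file
rev 2, names shortened under a term-level `open Literature.Geometry.Lorentzian in`), so its type is
the route decl `…Theses.TemporalBandLiouville.Assembly` up to `δ`-unfolding of the five route
definitions (`Assembly`, `BandFromNonradiation`, `BandLimitedLiouville`,
`StationaryLimitReduction`, `EternalExteriorStationary`), and nothing else.

Nothing mathematical is used or claimed here; in particular no crux is proved.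
-/

namespace Summit.FinalStateConjecture.FinalStateConjecture.Theorems

/-- **`Assembly` of route TemporalBandLiouville** (item stmt-FinalStateConjecture-10176):
`BandFromNonradiation → BandLimitedLiouville → StationaryLimitReduction → FinalStateConjecture`,
the route definitions written out verbatim (first antecedent = C1 "band from non-radiation",
second antecedent = C2 "band-limited Liouville", third antecedent = R "stationary-limit
reduction" `EternalExteriorStationary → FinalStateConjecture` with X = `EternalExteriorStationary`
inlined, conclusion = the summit Statement `FinalStateConjecture`), so that this type `δ`-unfolds
to `Summit.FinalStateConjecture.FinalStateConjecture.Theses.TemporalBandLiouville.Assembly`.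
Proof: given the hypothesis bundle `hG` of X for `(a, r₀, G)`, C1 yields the temporal band
`hB a r₀ G hG`, C2 applied to the same bundle and that band yields `t`-independence, so X holds;
R maps X to the Statement. -/
theorem TemporalBandLiouville.assembly_proof :
    open Literature.Geometry.Lorentzian in
      (∀ (a r₀ : ℝ) (G : E4 → E4 →L[ℝ] E4 →L[ℝ] ℝ), (0 < r₀ ∧ MetricCoord.IsMetricOn G (Kerr.region
            a r₀ : Set E4)
        ∧ (∃ c₀ δ : ℝ, 0 < c₀ ∧ 0 < δ ∧ ∀ x ∈ Kerr.region a r₀, (E4.dx 0) (MetricCoord.sharpAt G x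
            (E4.dx 0)) ≤ -c₀ ∧ (Kerr.radius a x < r₀ + δ → (fderiv ℝ (Kerr.radius a) x)
            (MetricCoord.sharpAt G x (fderiv ℝ (Kerr.radius a) x)) ≤ -c₀ ∧ c₀ ≤ (E4.dx 0)
            (MetricCoord.sharpAt G x (fderiv ℝ (Kerr.radius a) x))))
        ∧ (∀ x ∈ Kerr.region a r₀, MetricCoord.ricAt G x = 0)
        ∧ (∀ x ∈ Kerr.region a r₀, ∑ β : Fin 4, MetricCoord.chrAt G x (MetricCoord.sharpAt G x
            (E4.dx β)) (E4.basisVector β) = 0)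
        ∧ (∀ k : ℕ, ∃ C : ℝ, ∀ x ∈ Kerr.region a r₀, ‖iteratedFDeriv ℝ k G x‖ ≤ C ∧
            ‖MetricCoord.sharpAt G x‖ ≤ C)
        ∧ (∃ C : ℝ, ∀ x ∈ Kerr.region a r₀, ‖G x - Minkowski.bilin‖ ≤ C / E4.spatialNorm x ∧
            ‖iteratedFDeriv ℝ 1 G x‖ ≤ C / E4.spatialNorm x ^ 2 ∧ ‖iteratedFDeriv ℝ 2 G x‖ ≤ C /
            E4.spatialNorm x ^ 3))
        → (∃ b C : ℝ, ∀ x ∈ Kerr.region a r₀, ∀ v w : E4, ∃ F : ℂ → ℂ, Differentiable ℂ F ∧ (∀ z :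
            ℂ, ‖F z‖ ≤ C * ‖v‖ * ‖w‖ * Real.exp (b * |z.im|)) ∧ ∀ s : ℝ, F (s : ℂ) = ((G (x + s •
            E4.basisVector 0) v w : ℝ) : ℂ))) →
      (∀ (a r₀ : ℝ) (G : E4 → E4 →L[ℝ] E4 →L[ℝ] ℝ), (0 < r₀ ∧ MetricCoord.IsMetricOn G (Kerr.region
            a r₀ : Set E4)
        ∧ (∃ c₀ δ : ℝ, 0 < c₀ ∧ 0 < δ ∧ ∀ x ∈ Kerr.region a r₀, (E4.dx 0) (MetricCoord.sharpAt G x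
            (E4.dx 0)) ≤ -c₀ ∧ (Kerr.radius a x < r₀ + δ → (fderiv ℝ (Kerr.radius a) x)
            (MetricCoord.sharpAt G x (fderiv ℝ (Kerr.radius a) x)) ≤ -c₀ ∧ c₀ ≤ (E4.dx 0)
            (MetricCoord.sharpAt G x (fderiv ℝ (Kerr.radius a) x))))
        ∧ (∀ x ∈ Kerr.region a r₀, MetricCoord.ricAt G x = 0)
        ∧ (∀ x ∈ Kerr.region a r₀, ∑ β : Fin 4, MetricCoord.chrAt G x (MetricCoord.sharpAt G x
            (E4.dx β)) (E4.basisVector β) = 0)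
        ∧ (∀ k : ℕ, ∃ C : ℝ, ∀ x ∈ Kerr.region a r₀, ‖iteratedFDeriv ℝ k G x‖ ≤ C ∧
            ‖MetricCoord.sharpAt G x‖ ≤ C)
        ∧ (∃ C : ℝ, ∀ x ∈ Kerr.region a r₀, ‖G x - Minkowski.bilin‖ ≤ C / E4.spatialNorm x ∧
            ‖iteratedFDeriv ℝ 1 G x‖ ≤ C / E4.spatialNorm x ^ 2 ∧ ‖iteratedFDeriv ℝ 2 G x‖ ≤ C /
            E4.spatialNorm x ^ 3))
        → (∃ b C : ℝ, ∀ x ∈ Kerr.region a r₀, ∀ v w : E4, ∃ F : ℂ → ℂ, Differentiable ℂ F ∧ (∀ z :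
            ℂ, ‖F z‖ ≤ C * ‖v‖ * ‖w‖ * Real.exp (b * |z.im|)) ∧ ∀ s : ℝ, F (s : ℂ) = ((G (x + s •
            E4.basisVector 0) v w : ℝ) : ℂ))
        → ∀ x ∈ Kerr.region a r₀, ∀ s : ℝ, G (x + s • E4.basisVector 0) = G x) →
      ((∀ (a r₀ : ℝ) (G : E4 → E4 →L[ℝ] E4 →L[ℝ] ℝ), (0 < r₀ ∧ MetricCoord.IsMetricOn G (Kerr.region
            a r₀ : Set E4)
        ∧ (∃ c₀ δ : ℝ, 0 < c₀ ∧ 0 < δ ∧ ∀ x ∈ Kerr.region a r₀, (E4.dx 0) (MetricCoord.sharpAt G x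
            (E4.dx 0)) ≤ -c₀ ∧ (Kerr.radius a x < r₀ + δ → (fderiv ℝ (Kerr.radius a) x)
            (MetricCoord.sharpAt G x (fderiv ℝ (Kerr.radius a) x)) ≤ -c₀ ∧ c₀ ≤ (E4.dx 0)
            (MetricCoord.sharpAt G x (fderiv ℝ (Kerr.radius a) x))))
        ∧ (∀ x ∈ Kerr.region a r₀, MetricCoord.ricAt G x = 0)
        ∧ (∀ x ∈ Kerr.region a r₀, ∑ β : Fin 4, MetricCoord.chrAt G x (MetricCoord.sharpAt G x
            (E4.dx β)) (E4.basisVector β) = 0)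
        ∧ (∀ k : ℕ, ∃ C : ℝ, ∀ x ∈ Kerr.region a r₀, ‖iteratedFDeriv ℝ k G x‖ ≤ C ∧
            ‖MetricCoord.sharpAt G x‖ ≤ C)
        ∧ (∃ C : ℝ, ∀ x ∈ Kerr.region a r₀, ‖G x - Minkowski.bilin‖ ≤ C / E4.spatialNorm x ∧
            ‖iteratedFDeriv ℝ 1 G x‖ ≤ C / E4.spatialNorm x ^ 2 ∧ ‖iteratedFDeriv ℝ 2 G x‖ ≤ C /
            E4.spatialNorm x ^ 3))
        → ∀ x ∈ Kerr.region a r₀, ∀ s : ℝ, G (x + s • E4.basisVector 0) = G x) →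
        _root_.FinalStateConjecture) →
      _root_.FinalStateConjecture := by
  intro hB hL hR
  exact hR fun a r₀ G hG => hL a r₀ G hG (hB a r₀ G hG)

end Summit.FinalStateConjecture.FinalStateConjecture.Theorems
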